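import Mathlib
import Summits.Langlands.Langlands.Theses.ParityBlindBianchi
import Literature.NumberTheory.Automorphic.TunnellLemma
import Literature.NumberTheory.Automorphic.BaseChangeStrongUnramified
import Literature.NumberTheory.Automorphic.BaseChangeCyclicCuspidal
import Summits.Langlands.Langlands.Theorems.IcosahedralDescentLevel.Negative.DoorOfInhabited
import Summits.Langlands.Langlands.Theorems.ParityBlindBianchiIcosahedralDescentLevelMain

/-!
# Skeleton (line `Sketch`, lead's variant; continuations c1, c2, c3, c4, c5) for crux stmt-Langlands-15113 `IcosahedralDescentLevel`

c5 (2026-08-16): re-owned and re-registered unchanged (5 stubs; composition concludes the crux by name).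
The door stub `stub_door_allParityArtin` is handed back at line level (`promote-stub`): it is not a lemma
of any line but, kernel-checked and with no hypothesis, the existing open rank-0 target
stmt-Langlands-10841 (`door_iff_strongArtinIcosahedralQ`, p116764) — so it must not be promoted to a NEW
item; the planner's move is the restatement D′ → D″ (`(0 : ℕ) ∉ S₀`), after which this very skeleton
closes the repaired item by `exact icosahedralDescentLevel_conditional` (p111861) modulo F1–F4.


c4 (2026-08-16): modulo the two PRINTED theorems `khareWintenberger_artinConjecture_of_isOdd`
(Khare–Wintenberger 2009) and `booker_strongArtin_of_artinConjecture` (Booker 2003) the typed crux is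
THIS ROUTE'S OWN rank-0 target: `iff_evenIcosahedralStrongArtin : … → … → (IcosahedralDescentLevel ↔
EvenIcosahedralStrongArtin)` (`Theorems/ParityBlindBianchiIcosahedralDescentLevelCircular.lean`; parity
dichotomy `isOdd_or_isEven` over `ℚ` proved + the tree's `strongArtin_ae_of_isOdd`).  So `closes` is
circular as typed; the door stub below is (mod print) the target stmt-Langlands-2903 itself.  Stubs and
composition unchanged.

c3 (2026-08-16): the door stub below is now identified UNCONDITIONALLY, by name, with the open rank-0
target `Summit.Langlands.Langlands.Theses.GaloisWeightedBE.StrongArtinIcosahedralQ` (stmt-Langlands-10841)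
— `door_iff_strongArtinIcosahedralQ` and `iff_strongArtinIcosahedralQ : IcosahedralDescentLevel ↔
StrongArtinIcosahedralQ` (no hypothesis; Gelbart's cuspidal inhabitation is the tree's theorem
`nonempty_cuspidalAutomorphicRepData_two_holds`), `Theorems/ParityBlindBianchiIcosahedralDescentLevelEquiv.lean`.
So the typed crux closes exactly when stmt-Langlands-10841 does and the four fact stubs are irrelevant to
it AS TYPED; they (and the landed D″) are the content of the REPAIRED statement only.

THE CRUX AS TYPED IS MISSTATED: its hypothesis `∃ S₀ : Finset ℕ, …` admits `S₀ = {0}`, for which no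
place is good and the compatibility clause is vacuous (landed: p90502
`Theorems/IcosahedralDescentLevel/Negative/AllParityOfDoorOfDescent.lean`), so as typed it contains
all-parity icosahedral strong Artin over `ℚ`.  The line proves the REPAIRED statement (`0 ∉ S₀`) from
the four named base-change facts of the tree (F1 `cuspidal_descent_cyclic`, F2
`ArthurClozel1989_strongLifting_unramified`, F3 `baseChange_cyclic_cuspidal`, F4
`ArthurClozel_fibres_quadratic`) — that proof, `icosahedralDescentLevel_repaired`, is LANDED sorry-free
(modulo F1–F4 as hypotheses) in `Theorems/ParityBlindBianchiIcosahedralDescentLevelMain.lean` (p111861)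
together with its seven lemma files `…IcosahedralDescentLevel{AuxPrime,Inert,Witness,Anchor,CaseB,ReadOff,
Transfer}.lean` and is IMPORTED here (continuation c1: no sorried copy any more) — and concludes the crux
BY NAME through the refuter's exact decomposition `typed ↔ repaired ∧ door`
(`Negative.icosahedralDescentLevel_iff_repaired_and_door`, p98657): the remaining registered gaps are
NAMED only — the four fact stubs (XL named facts F1–F4 of the tree, on the Literature debt queue) and the
door stub `stub_door_allParityArtin` (= the misstatement, all-parity icosahedral strong Artin; NOT claimed).
-/

-- `Summit.Langlands.Langlands.…`: the repeated path component is the tree's layout (D-0017).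
set_option linter.dupNamespace false

noncomputable section

open scoped MatrixGroups NumberField Polynomial Classical
open NumberField IsDedekindDomain Field Filter
open Literature.NumberTheory.Automorphic Literature.NumberTheory.GaloisRepresentations
open Summit.Langlands.Langlands.Theses.ParityBlindBianchi

namespace Summit.Langlands.Langlands.Theorems.IcosahedralDescentLevel

/-! ### Named facts of the tree entering the line (XL, trace formula; NOT worked by this line — they are
the item's recorded `needs-fact` debts, registered so that `IcosahedralDescentLevel_of` is closed
modulo named gaps only) -/

/-- STUB-FACT F1: cyclic descent of prime degree (Arthur–Clozel III.4.2 (d)); the tree's named fact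
`cuspidal_descent_cyclic`, undischarged. [cite: ArthurClozelAMS120, Ch. 3 Thm. 4.2 (d)] -/
theorem stub_fact_descent : cuspidal_descent_cyclic := by
  sorry

/-- STUB-FACT F2: strong lifting at unramified places (Arthur–Clozel III.5.1); the tree's named fact
`ArthurClozel1989_strongLifting_unramified`, undischarged. [cite: ArthurClozelAMS120, Ch. 3 Thm. 5.1] -/
theorem stub_fact_strongLifting : ArthurClozel1989_strongLifting_unramified := by
  sorry

/-- STUB-FACT F3: cuspidality of cyclic base change (Arthur–Clozel III.4.2 (a)); the tree's named fact
`baseChange_cyclic_cuspidal`, undischarged. [cite: ArthurClozelAMS120, Ch. 3 Thm. 4.2 (a)] -/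
theorem stub_fact_baseChangeCuspidal : baseChange_cyclic_cuspidal := by
  sorry

/-- STUB-FACT F4: fibres of quadratic base change (Arthur–Clozel III.3.1); the tree's named fact
`ArthurClozel_fibres_quadratic`, reduced in the tree to Jacquet–Shalika leaves
(`ArthurClozel_fibres_quadratic_of_leaves'`), undischarged. [cite: ArthurClozelAMS120, Ch. 3 Thm. 3.1] -/
theorem stub_fact_fibres : ArthurClozel_fibres_quadratic := by
  sorry

/-! ### The misstatement gap (NOT claimed): the door -/

/-- STUB-DOOR (NOT a lemma of the line; not expected provable): the second conjunct of the refuter's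
exact decomposition `IcosahedralDescentLevel ↔ repaired ∧ door`
(`Negative.icosahedralDescentLevel_iff_repaired_and_door`, p98657) — strong Artin (a.e.) for EVERY
irreducible icosahedral `ρ/ℚ`, odd or even, granted only a 2-adic model of `ρ|_K` and SOME cuspidal
datum on `GL₂/K` for every 2-split imaginary quadratic `K`.  This is exactly what the typed crux
asserts beyond its repaired form; it is registered so that the skeleton is closed modulo NAMED gaps
and isolates the misstatement for the planner (`∃ S₀, 0 ∉ S₀ ∧ …`). [folklore] -/
theorem stub_door_allParityArtin :
    ∀ (ι : PadicAlgCl 2 ≃+* ℂ) (ρ : FramedGaloisRep ℚ ℂ 2), ρ.toGaloisRep.IsIrreducible →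
      Nonempty ((Matrix.ProjGenLinGroup.mk.comp ρ.toMonoidHom).range ≃* alternatingGroup (Fin 5)) →
      (∀ (K : Type) [Field K] [NumberField K], NumberField.IsTotallyComplex K →
        Module.finrank ℚ K = 2 →
        (∃ v w : HeightOneSpectrum (𝓞 K), v ≠ w ∧ ((2 : ℕ) : 𝓞 K) ∈ v.asIdeal ∧
          ((2 : ℕ) : 𝓞 K) ∈ w.asIdeal) →
        ∃ (σ : FramedGaloisRep K (PadicAlgCl 2) 2) (hcpt : isCompact_glFiniteIntegralLevel 2 K)
          (_π : CuspidalAutomorphicRepData 2 K hcpt),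
          ∀ (g : absoluteGaloisGroup K) (i j : Fin 2),
            ι ((σ g).val i j) = ((FramedGaloisRep.restrictField K ρ) g).val i j) →
      ∃ (hcpt : isCompact_glFiniteIntegralLevel 2 ℚ) (π : CuspidalAutomorphicRepData 2 ℚ hcpt),
        ∀ᶠ v : HeightOneSpectrum (𝓞 ℚ) in cofinite, ∃ α : Multiset ℂ,
          π.1.HasSatakeParamAt v α ∧ ρ.IsUnramifiedAt v ∧
            ρ.HasFrobCharpolyAt v (satakePolynomial α) := by
  sorry

/-! ### The line's theorem is LANDED: `icosahedralDescentLevel_repaired`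
(`Theorems/ParityBlindBianchiIcosahedralDescentLevelMain.lean`, p111861, imported above; type:
`cuspidal_descent_cyclic → ArthurClozel1989_strongLifting_unramified → baseChange_cyclic_cuspidal →
ArthurClozel_fibres_quadratic → ∀ ι ρ S₀, 0 ∉ S₀ → (uniform family off S₀) → (a.e. strong Artin for ρ)`). -/

/-- **Skeleton conclusion.**  `IcosahedralDescentLevel` AS TYPED, from the registered stubs only,
through the refuter's exact decomposition `typed ↔ repaired ∧ door`
(`Negative.icosahedralDescentLevel_iff_repaired_and_door`): the repaired conjunct is the line's LANDED
theorem `icosahedralDescentLevel_repaired` fed with the fact stubs F1–F4, the door conjunct is the stub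
`stub_door_allParityArtin` — NOT claimed (it is the misstatement). [folklore] -/
theorem IcosahedralDescentLevel_of : IcosahedralDescentLevel :=
  Negative.icosahedralDescentLevel_iff_repaired_and_door.mpr
    ⟨fun ι ρ _ _ ⟨S₀, h0, hK⟩ => icosahedralDescentLevel_repaired stub_fact_descent
        stub_fact_strongLifting stub_fact_baseChangeCuspidal stub_fact_fibres ι ρ S₀ h0 hK,
      stub_door_allParityArtin⟩

end Summit.Langlands.Langlands.Theorems.IcosahedralDescentLevel

end
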